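import Literature.AlgebraicGeometry.HodgeTheory.WeightOneHodgeStructuresOfCurves
import Literature.AlgebraicGeometry.HodgeTheory.LefschetzPencilHyperplaneSectionsProofs
import Literature.AlgebraicGeometry.HodgeTheory.HodgeStructureOfHodgeModel
import Literature.AlgebraicGeometry.HodgeTheory.HodgeFiltrationModelsReductionProofs
import Literature.AlgebraicGeometry.HodgeTheory.ComplexConjugationHolds
import Literature.AlgebraicGeometry.HodgeTheory.HodgeRiemannPolarizabilityProofs
import Literature.AlgebraicGeometry.HodgeTheory.RationalLattice
import Literature.AlgebraicGeometry.Motives.HodgeStructureSemisimple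
import Literature.AlgebraicGeometry.Motives.HodgeStructureStrictProofs
import Literature.AlgebraicGeometry.Motives.HodgeStructureDirectSum
import Literature.AlgebraicGeometry.Motives.JacobianDimensionProofs
import Literature.AlgebraicGeometry.Motives.VarietiesProjectiveSpaceProofs
import Literature.AlgebraicGeometry.Motives.SegreEmbedding
import Literature.NumberTheory.Transcendental.AnalytificationConnected
import HarnessLib

/-!
# Riemann's theorem on weight-one Hodge structures: the curve form from the geometric form

Fourth PROOFS file of `HodgeTheory/WeightOneHodgeStructuresOfCurves`. The named fact
`weightOne_polarizable_eq_range_of_curve` (every polarisable effective weight-one `ℚ`-Hodge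
structure is a Hodge quotient of `H¹(C(ℂ); ℚ)` of a smooth projective CURVE) is reduced to the
named fact `weightOne_polarizable_eq_range_of_smoothProjective` (the same with a smooth projective
variety `X` of any dimension — Riemann's theorem, geometric form), WITHOUT Jacobians: instead of
"every abelian variety is a quotient of a Jacobian" (Lange–Birkenhake Prop. 4.5.8) we cut `X × ℙ¹`
by general hyperplane sections down to a smooth curve `C ⊆ X × ℙ¹` (the pencil nets of
`LefschetzPencilHyperplaneSections`, whose smooth members satisfy the Lefschetz hyperplane theorem,
PROVED in the tree), so that `H¹(X) ↪ H¹(X × ℙ¹) ↪ H¹(C)` is an injective morphism of Hodge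
structures (pull-backs are morphisms of Hodge structures, `HodgeModel.hodgeStructureHom`), and split
it by the semisimplicity of polarisable Hodge structures (Voisin I Lemma 7.26 / Voisin 2025
Prop. 2.11, `SubHodgeStructure.exists_isCompl_eq_orthogonal`, with the strictness of morphisms,
`Hom.strict_holds`): an injective morphism into a polarisable structure has a LEFT INVERSE
(`Hom.exists_leftInverse_of_injective`). Composing the left inverse `H¹(C) ↠ H¹(X)` with the
geometric form's `H¹(X) ↠ H` gives the curve form.

## Main results

* `Motives.HodgeStructure.Hom.exists_leftInverse_of_injective` — an injective morphism of Hodge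
  structures into a finite-dimensional polarisable Hodge structure has a left inverse morphism.
* `exists_curve_complexBetti_map_one_injective` — every smooth projective `X/ℂ` of dimension
  `r + 1` receives a morphism from a smooth projective curve `C ⟶ X` injective on `H¹(–(ℂ); ℂ)`.
* `weightOne_polarizable_eq_range_of_curve_of_geometric` —
  `weightOne_polarizable_eq_range_of_smoothProjective → weightOne_polarizable_eq_range_of_curve`.

## References

* [VoisinHodgeI2002] C. Voisin, Hodge Theory and Complex Algebraic Geometry I, §7.3.1 Lemma 7.26.
* [VoisinHodgeII2003] C. Voisin, Hodge Theory and Complex Algebraic Geometry II, §1.2.2 Thm. 1.23,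
  §2.1.1.
* [Voisin2025] C. Voisin, Hodge and generalized Hodge conjectures, coniveau and algebraic cycles,
  Prop. 2.11.
* [KerrPearlstein2016] Kerr–Pearlstein (eds.), Recent Advances in Hodge Theory, Ch. 11 §1 p. 288.
* [LangeBirkenhake1992] H. Lange, Ch. Birkenhake, Complex Abelian Varieties, Prop. 4.5.8.
-/

noncomputable section

open scoped TensorProduct
open CategoryTheory AlgebraicGeometry MonoidalCategory CartesianMonoidalCategory

/-! ### §A. Left inverses of injective morphisms into polarisable Hodge structures -/

namespace Literature.AlgebraicGeometry.HodgeTheory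

open Literature.AlgebraicTopology.SingularHomology
open Literature.AlgebraicGeometry.Motives
open Literature.AlgebraicGeometry.Motives.HodgeStructure

section LeftInverse

universe u v

variable {V : Type u} [AddCommGroup V] [Module ℚ V]
variable {V' : Type v} [AddCommGroup V'] [Module ℚ V']
variable {n : ℤ}

/-- Complementary `ℚ`-subspaces have disjoint complexifications (apply the complexified projection
onto the first summand along the second). [folklore] -/
theorem disjoint_baseChange_of_isCompl {S K : Submodule ℚ V} (h : IsCompl S K) :
    Disjoint (S.baseChange ℂ) (K.baseChange ℂ) := by
  rw [Submodule.disjoint_def]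
  rintro y ⟨u, rfl⟩ ⟨u', hu'⟩
  have h1 : (S.projection K h).baseChange ℂ (S.subtype.baseChange ℂ u) = S.subtype.baseChange ℂ u := by
    rw [← LinearMap.comp_apply, ← LinearMap.baseChange_comp]
    have hc : S.projection K h ∘ₗ S.subtype = S.subtype :=
      LinearMap.ext fun v ↦ Submodule.projection_apply_left h v
    rw [hc]
  have h2 : (S.projection K h).baseChange ℂ (K.subtype.baseChange ℂ u') = 0 := by
    rw [← LinearMap.comp_apply, ← LinearMap.baseChange_comp]
    have hc : S.projection K h ∘ₗ K.subtype = 0 :=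
      LinearMap.ext fun v ↦ Submodule.projection_apply_right h v
    rw [hc, LinearMap.baseChange_zero, LinearMap.zero_apply]
  rw [← h1, ← hu', h2]

/-- **An injective morphism of Hodge structures into a finite-dimensional polarisable Hodge
structure has a left inverse** (as a morphism of Hodge structures; dot-notation extension of
`Motives.HodgeStructure.Hom`, declared here with its absolute name). Proof (Voisin I Lemma 7.26;
Voisin 2025 Prop. 2.11 and the proof of Cor. 2.12: "`φ` has a left inverse as morphism of Hodge
structures"): the image `S` of `ι` is a sub-Hodge structure (`Hom.exists_subHodgeStructure_range`),
`V = S ⊕ S^⊥` with `S^⊥` a sub-Hodge structure (`SubHodgeStructure.exists_isCompl_eq_orthogonal`);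
the projection onto `S` along `S^⊥` preserves `F` (both summands split along `Fᵖ ⊕ conj F^q`,
`p + q = n + 1`, and `Fᵖ ∩ conj F^q = 0`), and `ι⁻¹ : S → V'` preserves `F` by the strictness of
`ι` (`Hom.strict_holds`). [cite: VoisinHodgeI2002, §7.3.1 Lemma 7.26] [cite: Voisin2025, Prop. 2.11 and Cor. 2.12] -/
theorem _root_.Literature.AlgebraicGeometry.Motives.HodgeStructure.Hom.exists_leftInverse_of_injective
    [Module.Finite ℚ V] {H' : HodgeStructure V' n} {H : HodgeStructure V n} (ι : Hom H' H)
    (hι : Function.Injective ι.toLinearMap) (hH : H.IsPolarizable) :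
    ∃ r : Hom H H', r.toLinearMap ∘ₗ ι.toLinearMap = LinearMap.id := by
  obtain ⟨Q⟩ := hH
  obtain ⟨S, hS⟩ := ι.exists_subHodgeStructure_range
  obtain ⟨K, -, hcompl⟩ := S.exists_isCompl_eq_orthogonal Q
  have hcompl' : IsCompl (LinearMap.range ι.toLinearMap) K.toSubmodule := hS ▸ hcompl
  set r₀ : V →ₗ[ℚ] V' := LinearMap.linearProjOfIsCompl K.toSubmodule ι.toLinearMap hι hcompl'
    with hr₀
  have hleft : ∀ y, r₀ (ι.toLinearMap y) = y := fun y ↦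
    LinearMap.linearProjOfIsCompl_apply_left K.toSubmodule ι.toLinearMap hι hcompl' y
  have hright : ∀ x ∈ K.toSubmodule, r₀ x = 0 := fun x hx ↦
    LinearMap.linearProjOfIsCompl_apply_right' K.toSubmodule ι.toLinearMap hι hcompl' x hx
  have hrι : r₀ ∘ₗ ι.toLinearMap = LinearMap.id := LinearMap.ext hleft
  have hrK : r₀ ∘ₗ K.toSubmodule.subtype = 0 := LinearMap.ext fun x ↦ hright x x.2
  refine ⟨⟨r₀, fun p ↦ ?_⟩, hrι⟩
  rintro _ ⟨x, hx, rfl⟩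
  set ιc := ι.toLinearMap.baseChange ℂ with hιc
  set σS := S.toSubmodule.subtype.baseChange ℂ with hσS
  set σK := K.toSubmodule.subtype.baseChange ℂ with hσK
  set q : ℤ := n + 1 - p with hq
  have hpq : p + q = n + 1 := by omega
  -- `x = s + k` along `V_ℂ = S_ℂ ⊕ K_ℂ`
  set w := (S.toSubmodule.projectionOnto K.toSubmodule hcompl).baseChange ℂ x with hw
  set w' := (K.toSubmodule.projectionOnto S.toSubmodule hcompl.symm).baseChange ℂ x with hw'
  have hdec : σS w + σK w' = x := by
    rw [hw, hw', hσS, hσK, ← LinearMap.comp_apply, ← LinearMap.baseChange_comp,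
      ← LinearMap.comp_apply (f := K.toSubmodule.subtype.baseChange ℂ), ← LinearMap.baseChange_comp,
      ← LinearMap.add_apply, ← LinearMap.baseChange_add]
    change ((S.toSubmodule.projection K.toSubmodule hcompl +
      K.toSubmodule.projection S.toSubmodule hcompl.symm).baseChange ℂ) x = x
    rw [Submodule.projection_add_projection_eq_id hcompl, LinearMap.baseChange_id, LinearMap.id_apply]
  -- split `w`, `w'` along `Fᵖ ⊕ conj F^q` inside the sub-Hodge structures `S`, `K`
  have hwS : w ∈ (H.F p).comap σS ⊔ (complexConj (H.F q)).comap σS := by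
    rw [(S.isCompl p q hpq).sup_eq_top]
    exact Submodule.mem_top
  have hwK : w' ∈ (H.F p).comap σK ⊔ (complexConj (H.F q)).comap σK := by
    rw [(K.isCompl p q hpq).sup_eq_top]
    exact Submodule.mem_top
  obtain ⟨a, ha, b, hb, hab⟩ := Submodule.mem_sup.1 hwS
  obtain ⟨a', ha', b', hb', hab'⟩ := Submodule.mem_sup.1 hwK
  rw [Submodule.mem_comap] at ha hb ha' hb'
  have hx' : x = (σS a + σK a') + (σS b + σK b') := by
    rw [← hdec, ← hab, ← hab', map_add, map_add]
    abel
  -- `σS b + σK b' ∈ Fᵖ ∩ conj F^q = 0`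
  have hzero : σS b + σK b' = 0 := by
    have h1 : σS b + σK b' ∈ H.F p := by
      have h := (H.F p).sub_mem hx ((H.F p).add_mem ha ha')
      rwa [hx', add_sub_cancel_left] at h
    have h2 : σS b + σK b' ∈ complexConj (H.F q) := (complexConj (H.F q)).add_mem hb hb'
    rw [← Submodule.mem_bot ℂ, ← (H.isCompl_F_complexConj p q hpq).inf_eq_bot]
    exact ⟨h1, h2⟩
  -- hence `σS b = 0` (`S_ℂ ∩ K_ℂ = 0`) and `s = σS a ∈ Fᵖ`
  have hSb : σS b = 0 := by
    have hmemS : σS b ∈ S.toSubmodule.baseChange ℂ := ⟨b, rfl⟩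
    have hmemK : σS b ∈ K.toSubmodule.baseChange ℂ :=
      ⟨-b', by rw [map_neg, eq_comm, eq_neg_iff_add_eq_zero]; exact hzero⟩
    exact (Submodule.disjoint_def.1 (disjoint_baseChange_of_isCompl hcompl)) _ hmemS hmemK
  have hs_F : σS w ∈ H.F p := by
    rw [← hab, map_add, hSb, add_zero]
    exact ha
  -- `σS w ∈ im ι_ℂ`, so by strictness `σS w = ι_ℂ y` with `y ∈ Fᵖ`
  have hs_range : σS w ∈ LinearMap.range ιc := by
    rw [hιc, range_baseChange, ← hS]
    exact ⟨w, rfl⟩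
  have hs_map : σS w ∈ (H'.F p).map ιc := by
    rw [hιc, Hom.strict_holds ι p]
    exact ⟨hs_F, hs_range⟩
  obtain ⟨y, hy, hys⟩ := hs_map
  -- `r_ℂ x = r_ℂ (ι_ℂ y) + r_ℂ (σK w') = y`
  have hr1 : r₀.baseChange ℂ (ιc y) = y := by
    rw [hιc, ← LinearMap.comp_apply, ← LinearMap.baseChange_comp, hrι, LinearMap.baseChange_id,
      LinearMap.id_apply]
  have hr2 : r₀.baseChange ℂ (σK w') = 0 := by
    rw [hσK, ← LinearMap.comp_apply, ← LinearMap.baseChange_comp, hrK, LinearMap.baseChange_zero,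
      LinearMap.zero_apply]
  rw [← hdec, map_add, ← hys, hr1, hr2, add_zero]
  exact hy

end LeftInverse

/-! ### §B. Curve sections: `H¹(X) ↪ H¹(C)` for a smooth curve `C ⟶ X` -/

/-- **Every smooth projective complex variety of positive dimension receives a morphism from a
smooth projective curve which is injective on `H¹(–(ℂ); ℂ)`** — iterated general hyperplane
sections: a pencil net of hyperplane sections of `X` (dimension `r + 2`) has a smooth member `X_t`
over a complex point `t` of its (open, non-empty) smooth base, the inclusion `X_t ⟶ X̃ ⟶ X`
induces an injection (indeed a bijection for `r ≥ 1`) on `H¹` by the Lefschetz hyperplane theorem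
(`exists_fiberNet_pencil_weakLefschetz_holds`, Voisin II Thm. 1.23 with §2.1.1), and one concludes
by induction on the dimension. [cite: VoisinHodgeII2003, §1.2.2 Thm. 1.23 and §2.1.1]
[cite: Hartshorne1977, II Thm. 8.18] -/
theorem exists_curve_complexBetti_map_one_injective :
    ∀ (r : ℕ) ⦃X : SchemeOver ℂ⦄, IsSmoothProjective (r + 1) X →
      ∃ (C : SchemeOver ℂ) (_ : IsSmoothProjective 1 C) (ι : C ⟶ X),
        Function.Injective (complexBetti.map ι 1) := by
  intro r
  induction r with
  | zero =>
    intro X hX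
    exact ⟨X, hX, 𝟙 X, by rw [complexBetti.map_id]; exact Function.injective_id⟩
  | succ r ih =>
    intro X hX
    -- a pencil net of `(r+1)`-folds on `X` whose smooth members satisfy weak Lefschetz
    obtain ⟨N, hN⟩ := exists_fiberNet_pencil_weakLefschetz_holds (r + 1) (by omega)
      ((Nat.add_comm (r + 1) 1) ▸ hX)
    -- a complex point of the (open, non-empty) smooth base
    have hP : IsSmoothProjective 1 (projectiveSpace 1 ℂ) := isSmoothProjective_projectiveSpace_holds ℂ 1
    haveI := hP.smoothOfRelativeDimension
    haveI : Smooth (projectiveSpace 1 ℂ).hom := SmoothOfRelativeDimension.smooth 1 _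
    obtain ⟨t, ht⟩ := ComplexPoints.exists_pt_mem (X := projectiveSpace 1 ℂ)
      (Z := (N.smoothBase : Set (projectiveSpace 1 ℂ).left)) N.smoothBase_nonempty_of_charZero
      N.smoothBase.isOpen.isLocallyClosed
    -- the smooth member `X_t`, an `(r+1)`-fold, with `H¹(X) ↪ H¹(X_t)`
    have hXt : IsSmoothProjective (r + 1) (N.fiber t) := N.isSmoothProjective_fiber_of_mem_smoothBase t ht
    have hinj : Function.Injective (complexBetti.map (fiberι N.proj t ≫ N.blowDown) 1) := by
      rcases Nat.eq_zero_or_pos r with hr | hr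
      · subst hr
        exact (hN t ht).2
      · exact ((hN t ht).1 1 (by omega)).1
    obtain ⟨C, hC, ι', hι'⟩ := ih hXt
    refine ⟨C, hC, ι' ≫ (fiberι N.proj t ≫ N.blowDown), ?_⟩
    have hc : ⇑(complexBetti.map (ι' ≫ (fiberι N.proj t ≫ N.blowDown)) 1) =
        ⇑(complexBetti.map ι' 1) ∘ ⇑(complexBetti.map (fiberι N.proj t ≫ N.blowDown) 1) := by
      rw [complexBetti.map_comp]
      rfl
    rw [hc]
    exact hι'.comp hinj

/-- **The projection `X × ℙ¹ ⟶ X` is injective on `H¹(–(ℂ); ℂ)`**: it has the section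
`x ↦ (x, t₀)` for a complex point `t₀ ∈ ℙ¹(ℂ)`. [folklore] -/
theorem complexBetti_map_fst_projectiveLine_injective (X : SchemeOver ℂ) :
    Function.Injective (complexBetti.map (fst X (projectiveSpace 1 ℂ)) 1) := by
  obtain ⟨t₀⟩ := nonempty_algPoints_of_isSmoothProjective (isSmoothProjective_projectiveSpace_holds ℂ 1)
  set sec : X ⟶ X ⊗ projectiveSpace 1 ℂ := lift (𝟙 X) (toSpecOver X ≫ t₀) with hsec
  have hsec_fst : sec ≫ fst X (projectiveSpace 1 ℂ) = 𝟙 X := lift_fst _ _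
  have hc : ⇑(complexBetti.map (sec ≫ fst X (projectiveSpace 1 ℂ)) 1) =
      ⇑(complexBetti.map sec 1) ∘ ⇑(complexBetti.map (fst X (projectiveSpace 1 ℂ)) 1) := by
    rw [complexBetti.map_comp]
    rfl
  rw [hsec_fst, complexBetti.map_id] at hc
  refine Function.LeftInverse.injective (g := ⇑(complexBetti.map sec 1)) fun c ↦ ?_
  change (⇑(complexBetti.map sec 1) ∘ ⇑(complexBetti.map (fst X (projectiveSpace 1 ℂ)) 1)) c = c
  rw [← hc]
  rfl

/-! ### §C. The curve form of Riemann's theorem from the geometric form -/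

/-- **Riemann's theorem, curve form, from its geometric form.** If every finite-dimensional
polarisable effective weight-one `ℚ`-Hodge structure is a Hodge quotient of `H¹(X(ℂ); ℚ)` of a
smooth projective `X` (`weightOne_polarizable_eq_range_of_smoothProjective`), then it is a Hodge
quotient of `H¹(C(ℂ); ℚ)` of a smooth projective CURVE (`weightOne_polarizable_eq_range_of_curve`).
Proof: a smooth curve `j : C ⟶ X × ℙ¹ ⟶ X` with `j^*` injective on `H¹`
(`exists_curve_complexBetti_map_one_injective`, `complexBetti_map_fst_projectiveLine_injective`);
`j^*` is a morphism of Hodge structures `H¹(X; ℚ) → H¹(C; ℚ)` (`HodgeModel.hodgeStructureHom`, real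
model of `C`), injective (`ofRatClass` is injective and natural), hence has a left inverse
`H¹(C; ℚ) ↠ H¹(X; ℚ)` by the semisimplicity of the polarisable `H¹(C; ℚ)`
(`Hom.exists_leftInverse_of_injective`, `smoothProjective_hodgeStructure_isPolarizable_holds`);
compose with `H¹(X; ℚ) ↠ H`. This replaces "every abelian variety is a quotient of a Jacobian"
(Lange–Birkenhake Prop. 4.5.8) in Abdulali's argument. [cite: KerrPearlstein2016, Ch. 11 (Abdulali) §1 p. 288]
[cite: VoisinHodgeI2002, §7.3.1 Lemma 7.26] [cite: LangeBirkenhake1992, Prop. 4.5.8] -/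
theorem weightOne_polarizable_eq_range_of_curve_of_geometric
    (h : weightOne_polarizable_eq_range_of_smoothProjective) :
    weightOne_polarizable_eq_range_of_curve := by
  intro V _ _ _ H hpol heff
  obtain ⟨g, X, hX, B, hB, f, hf⟩ := h H hpol heff
  -- `Y = X × ℙ¹` has dimension `g + 1 ≥ 1`; a curve `C ⟶ Y ⟶ X` injective on `H¹`
  have hP : IsSmoothProjective 1 (projectiveSpace 1 ℂ) := isSmoothProjective_projectiveSpace_holds ℂ 1
  have hY : IsSmoothProjective (g + 1) (X ⊗ projectiveSpace 1 ℂ) :=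
    IsSmoothProjective.tensor_holds hX hP
  obtain ⟨C, hC, ι, hι⟩ := exists_curve_complexBetti_map_one_injective g hY
  set j : C ⟶ X := ι ≫ fst X (projectiveSpace 1 ℂ) with hj_def
  have hj : Function.Injective (complexBetti.map j 1) := by
    have hc : ⇑(complexBetti.map j 1) =
        ⇑(complexBetti.map ι 1) ∘ ⇑(complexBetti.map (fst X (projectiveSpace 1 ℂ)) 1) := by
      rw [hj_def, complexBetti.map_comp]
      rfl
    rw [hc]
    exact hι.comp (complexBetti_map_fst_projectiveLine_injective X)
  -- the pull-back morphism of Hodge structures `j^* : H¹(X; ℚ) → H¹(C; ℚ)`, injective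
  obtain ⟨BC, hBCr⟩ := exists_isReal_hodgeModel_holds 1 C hC
  have hBC : BC.IsHodgeSymmetric := hBCr.isHodgeSymmetric
  set φ := B.hodgeStructureHom hX hodgePQ_independent_of_hodgeModel_holds hB BC hC hBC j 1 with hφ_def
  have key : ∀ a, ofRatClass (ComplexPoints C) 1 (φ.toLinearMap a) =
      complexBetti.map j 1 (ofRatClass (ComplexPoints X) 1 a) :=
    fun a ↦ Motives.ofRatClass_map 1 (AlgPoints.mapContinuous (L := ℂ) j) a
  have hφinj : Function.Injective φ.toLinearMap := by
    intro a b hab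
    have h1 := congrArg (ofRatClass (ComplexPoints C) 1) hab
    rw [key, key] at h1
    exact ofRatClass_injective 1 (hj h1)
  -- a left inverse `r : H¹(C; ℚ) ↠ H¹(X; ℚ)` (semisimplicity), and the composite `f ∘ r`
  haveI := finite_singularCohomology_rat_complexPoints hC 1
  obtain ⟨r, hr⟩ := φ.exists_leftInverse_of_injective hφinj
    (smoothProjective_hodgeStructure_isPolarizable_holds hC BC hBC 1)
  have hrs : Function.Surjective r.toLinearMap := fun y ↦
    ⟨φ.toLinearMap y, by rw [← LinearMap.comp_apply, hr, LinearMap.id_apply]⟩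
  -- transport `r` to weight `(1 : ℤ)` (same map, same filtrations) and compose with `f`
  let rc : Hom ((BC.hodgeStructure hC hBC 1).cast Nat.cast_one)
      ((B.hodgeStructure hX hB 1).cast Nat.cast_one) :=
    ⟨r.toLinearMap, fun p ↦ by
      rw [cast_F, cast_F]
      exact r.map_F_le p⟩
  exact ⟨C, hC, BC, hBC, f.comp rc, hf.comp hrs⟩

end Literature.AlgebraicGeometry.HodgeTheory

end
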